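import Literature.AlgebraicGeometry.Frobenioids.PerfectionGroupification
import HarnessLib

/-!
# [FrdI] §0: `(M^gp)^pf ≃ (M^pf)^gp` — the perfection/groupification interchange is an ISOMORPHISM

Mochizuki, *The geometry of Frobenioids I: the general theory*, Kyushu J. Math. **62** (2008)
293–400, §0 "Monoids", kurims text p. 11 [cite: MochizukiFrdI2008, §0 p.11]: "`M^gp`", "`M^pf := lim_→ M`"
(the inductive system `… → M —(n·)→ M → …` indexed by `(ℕ_{≥1}, ∣)`).  Both constructions are left
adjoints (to the inclusions of groups, resp. perfect monoids, into commutative monoids), so they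
commute: the interchange homomorphism `gpPerfComparison M : (M^gp)^pf → (M^pf)^gp` of
`PerfectionGroupification.lean` (row M13-c3 piece P0, abc-iut-L1-t6) is BIJECTIVE for EVERY
commutative monoid `M` — no cancellativity is needed.  Used by [FrdII] Thm. 3.6 (i) (kurims p. 36): the
`Φ^gp`-factor of the rational function monoid `(Φ^fld)^pf = (Φ^gp × Φ^∡)^pf` of `C^ℚ = C^pf` is
`(Φ^gp)^pf ≅ (Φ^pf)^gp`, the groupified divisor monoid of the perfection
[cite: MochizukiFrdII2008, Thm 3.6 (i) p.36] (abc-iut cell, layer L1, row M13-c3 FILE B-generic, piece (3);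
general monoid algebra supplied by abc-iut-w5-d194).

Contents (classical; nothing here is specific to the abc programme or takes a side on [IUTchIII]):
* `Perfection.instCommGroup` — the perfection of a commutative GROUP is a commutative group
  (`(a^{1/n})⁻¹ = (a⁻¹)^{1/n}`), `Perfection.mk_inv`, `Perfection.inv_mk`;
* `gpPerfInverse M : (M^pf)^gp →* (M^gp)^pf` — `GrothendieckGroup.lift` of `(ι_gp)^pf : M^pf → (M^gp)^pf`;
* `gpPerfInverse_comp_gpPerfComparison = id`, `gpPerfComparison_comp_gpPerfInverse = id`,
  `gpPerfComparison_bijective`, **`gpPerfMulEquiv M : Perfection (M^gp) ≃* (Perfection M)^gp`**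
  (`gpPerfMulEquiv_apply = gpPerfComparison`, `gpPerfMulEquiv_symm_apply = gpPerfInverse`);
* `IsPerfect.prod` — a product of perfect monoids is perfect; `commGroupOfComm` — a group with
  commuting multiplication as a `CommGroup` (reducible constructor, for `letI`).
-/

noncomputable section

namespace Literature.AlgebraicGeometry.Frobenioids

open Function

universe w v

/-! ### The perfection of a commutative group is a group -/

namespace Perfection

variable {G : Type w} [CommGroup G]

/-- Inversion on `G^pf` for a commutative group `G`: `(a^{1/n})⁻¹ := (a⁻¹)^{1/n}` (well defined on the
inductive limit of [FrdI] §0 p. 11). [cite: MochizukiFrdI2008, §0 p.11] -/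
instance instInv : Inv (Perfection G) where
  inv := Quotient.map (fun x : G × ℕ+ => (x.1⁻¹, x.2)) fun x y h => by
    obtain ⟨K, hK⟩ := h
    refine ⟨K, ?_⟩
    show x.1⁻¹ ^ ((K : ℕ) * (y.2 : ℕ)) = y.1⁻¹ ^ ((K : ℕ) * (x.2 : ℕ))
    rw [inv_pow, inv_pow, hK]

/-- `(mk a n)⁻¹ = mk a⁻¹ n`. [cite: MochizukiFrdI2008, §0 p.11] -/
@[simp] theorem inv_mk (a : G) (n : ℕ+) : (mk a n)⁻¹ = mk a⁻¹ n := rfl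

/-- **`G^pf` is a commutative group** when `G` is (the inductive limit of groups along the power maps).
[cite: MochizukiFrdI2008, §0 p.11] -/
instance instCommGroup : CommGroup (Perfection G) :=
  { Perfection.instCommMonoid (M := G), Perfection.instInv with
    inv_mul_cancel := fun x => by
      obtain ⟨⟨a, n⟩, rfl⟩ := mk_surjective x
      change mk a⁻¹ n * mk a n = 1
      rw [mk_mul_mk, ← mul_pow, inv_mul_cancel, one_pow, mk_one] }

/-- `mk a⁻¹ n = (mk a n)⁻¹`. [cite: MochizukiFrdI2008, §0 p.11] -/
theorem mk_inv (a : G) (n : ℕ+) : mk a⁻¹ n = (mk a n)⁻¹ := rfl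

/-- `of` commutes with inversion. [cite: MochizukiFrdI2008, §0 p.11] -/
@[simp] theorem of_inv (a : G) : of G a⁻¹ = (of G a)⁻¹ := rfl

end Perfection

/-! ### The inverse interchange `(M^pf)^gp → (M^gp)^pf` and the isomorphism -/

section Interchange

variable (M : Type w) [CommMonoid M]

/-- `lift f ∘ of = f` for the groupification. [cite: MochizukiFrdI2008, §0 p.11] -/
theorem gp_lift_of {P : Type w} [CommMonoid P] {H : Type v} [CommGroup H] (f : P →* H) (a : P) :
    Algebra.GrothendieckGroup.lift f (Algebra.GrothendieckGroup.of a) = f a := by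
  have h := Algebra.GrothendieckGroup.lift.symm_apply_apply f
  rw [Algebra.GrothendieckGroup.lift_symm_apply] at h
  exact DFunLike.congr_fun h a

/-- Two group homomorphisms out of `P^gp` that agree on `P` are equal. [cite: MochizukiFrdI2008, §0 p.11] -/
theorem gp_hom_ext {P : Type w} [CommMonoid P] {H : Type v} [CommGroup H]
    {g g' : Algebra.GrothendieckGroup P →* H}
    (h : g.comp Algebra.GrothendieckGroup.of = g'.comp Algebra.GrothendieckGroup.of) : g = g' := by
  apply Algebra.GrothendieckGroup.lift.symm.injective
  rw [Algebra.GrothendieckGroup.lift_symm_apply, Algebra.GrothendieckGroup.lift_symm_apply]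
  exact h

/-- **The inverse interchange `(M^pf)^gp → (M^gp)^pf`**: the group homomorphism induced
(`GrothendieckGroup.lift`, the target `(M^gp)^pf` being a GROUP) by `(ι_gp)^pf : M^pf → (M^gp)^pf`.
[cite: MochizukiFrdI2008, §0 p.11] -/
def gpPerfInverse : Algebra.GrothendieckGroup (Perfection M) →* Perfection (Algebra.GrothendieckGroup M) :=
  Algebra.GrothendieckGroup.lift (Perfection.map (Algebra.GrothendieckGroup.of (M := M)))

/-- `gpPerfInverse` on `M^pf ⊆ (M^pf)^gp` is `(ι_gp)^pf`. [cite: MochizukiFrdI2008, §0 p.11] -/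
@[simp] theorem gpPerfInverse_of (p : Perfection M) :
    gpPerfInverse M (Algebra.GrothendieckGroup.of p) = Perfection.map Algebra.GrothendieckGroup.of p :=
  gp_lift_of _ p

/-- `gpPerfInverse` on classes: `[a^{1/n}]^{gp} ↦ [a]^{gp,1/n}`. [cite: MochizukiFrdI2008, §0 p.11] -/
theorem gpPerfInverse_of_mk (a : M) (n : ℕ+) :
    gpPerfInverse M (Algebra.GrothendieckGroup.of (Perfection.mk a n)) =
      Perfection.mk (Algebra.GrothendieckGroup.of a) n := by
  rw [gpPerfInverse_of, Perfection.map_mk]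

/-- `gpPerfInverse ∘ gpPerfComparison = id` on `(M^gp)^pf` (both are homomorphisms out of a perfection
into the PERFECT monoid `(M^gp)^pf` agreeing with `ι` on `M^gp`; on `M^gp` both are group homomorphisms
out of `M^gp` agreeing on `M`). [cite: MochizukiFrdI2008, §0 p.11] -/
theorem gpPerfInverse_comp_gpPerfComparison :
    (gpPerfInverse M).comp (gpPerfComparison M) = MonoidHom.id _ := by
  apply Literature.AnabelianGeometry.EtaleTheta.Perfection.hom_ext_of_isPerfect
    (isPerfect_perfection (M := Algebra.GrothendieckGroup M))
  rw [MonoidHom.comp_assoc, gpPerfComparison_comp_of, MonoidHom.id_comp]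
  apply gp_hom_ext
  rw [MonoidHom.comp_assoc, gpMap_comp_of, ← MonoidHom.comp_assoc]
  ext a
  change gpPerfInverse M (Algebra.GrothendieckGroup.of (Perfection.of M a)) =
    Perfection.of _ (Algebra.GrothendieckGroup.of a)
  rw [gpPerfInverse_of]
  rfl

/-- `gpPerfComparison ∘ gpPerfInverse = id` on `(M^pf)^gp` (group homomorphisms out of `(M^pf)^gp`
agreeing on `M^pf`; there both are homomorphisms out of the perfection `M^pf` into the PERFECT group
`(M^pf)^gp` agreeing on `M`). [cite: MochizukiFrdI2008, §0 p.11] -/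
theorem gpPerfComparison_comp_gpPerfInverse :
    (gpPerfComparison M).comp (gpPerfInverse M) = MonoidHom.id _ := by
  apply gp_hom_ext
  rw [MonoidHom.id_comp, MonoidHom.comp_assoc]
  apply Literature.AnabelianGeometry.EtaleTheta.Perfection.hom_ext_of_isPerfect (isPerfect_gp_perfection M)
  ext a
  change gpPerfComparison M (gpPerfInverse M (Algebra.GrothendieckGroup.of (Perfection.of M a))) =
    Algebra.GrothendieckGroup.of (Perfection.of M a)
  rw [gpPerfInverse_of, ← gpPerfComparison_of_of M a]
  rfl

/-- `gpPerfInverse (gpPerfComparison x) = x`. [cite: MochizukiFrdI2008, §0 p.11] -/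
@[simp] theorem gpPerfInverse_gpPerfComparison (x : Perfection (Algebra.GrothendieckGroup M)) :
    gpPerfInverse M (gpPerfComparison M x) = x :=
  DFunLike.congr_fun (gpPerfInverse_comp_gpPerfComparison M) x

/-- `gpPerfComparison (gpPerfInverse y) = y`. [cite: MochizukiFrdI2008, §0 p.11] -/
@[simp] theorem gpPerfComparison_gpPerfInverse (y : Algebra.GrothendieckGroup (Perfection M)) :
    gpPerfComparison M (gpPerfInverse M y) = y :=
  DFunLike.congr_fun (gpPerfComparison_comp_gpPerfInverse M) y

/-- **The interchange `(M^gp)^pf ≃ (M^pf)^gp` as an isomorphism of groups/monoids.**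
[cite: MochizukiFrdI2008, §0 p.11] -/
def gpPerfMulEquiv : Perfection (Algebra.GrothendieckGroup M) ≃* Algebra.GrothendieckGroup (Perfection M) :=
  MonoidHom.toMulEquiv (gpPerfComparison M) (gpPerfInverse M) (gpPerfInverse_comp_gpPerfComparison M)
    (gpPerfComparison_comp_gpPerfInverse M)

/-- `gpPerfMulEquiv` is `gpPerfComparison`. [cite: MochizukiFrdI2008, §0 p.11] -/
@[simp] theorem gpPerfMulEquiv_apply (x : Perfection (Algebra.GrothendieckGroup M)) :
    gpPerfMulEquiv M x = gpPerfComparison M x := rfl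

/-- The inverse of `gpPerfMulEquiv` is `gpPerfInverse`. [cite: MochizukiFrdI2008, §0 p.11] -/
@[simp] theorem gpPerfMulEquiv_symm_apply (y : Algebra.GrothendieckGroup (Perfection M)) :
    (gpPerfMulEquiv M).symm y = gpPerfInverse M y := rfl

/-- As a monoid homomorphism `gpPerfMulEquiv` is `gpPerfComparison`. [cite: MochizukiFrdI2008, §0 p.11] -/
theorem gpPerfMulEquiv_toMonoidHom : (gpPerfMulEquiv M).toMonoidHom = gpPerfComparison M := rfl

/-- **`gpPerfComparison` is bijective** for every commutative monoid. [cite: MochizukiFrdI2008, §0 p.11] -/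
theorem gpPerfComparison_bijective : Bijective (gpPerfComparison M) :=
  (gpPerfMulEquiv M).bijective

/-- `gpPerfComparison` is injective. [cite: MochizukiFrdI2008, §0 p.11] -/
theorem gpPerfComparison_injective : Injective (gpPerfComparison M) :=
  (gpPerfComparison_bijective M).1

/-- `gpPerfComparison` is surjective. [cite: MochizukiFrdI2008, §0 p.11] -/
theorem gpPerfComparison_surjective : Surjective (gpPerfComparison M) :=
  (gpPerfComparison_bijective M).2

/-- `gpPerfMulEquiv` on `M`: `[a]^{gp,pf} ↦ [a]^{pf,gp}`. [cite: MochizukiFrdI2008, §0 p.11] -/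
theorem gpPerfMulEquiv_of_of (a : M) :
    gpPerfMulEquiv M (Perfection.of _ (Algebra.GrothendieckGroup.of a)) =
      Algebra.GrothendieckGroup.of (Perfection.of M a) :=
  gpPerfComparison_of_of M a

/-- The inverse on classes: `[a^{1/n}]^{gp} ↦ [a]^{gp,1/n}`. [cite: MochizukiFrdI2008, §0 p.11] -/
theorem gpPerfMulEquiv_symm_of_mk (a : M) (n : ℕ+) :
    (gpPerfMulEquiv M).symm (Algebra.GrothendieckGroup.of (Perfection.mk a n)) =
      Perfection.mk (Algebra.GrothendieckGroup.of a) n :=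
  gpPerfInverse_of_mk M a n

/-- `gpPerfComparison` on classes of elements of `M`: `[a]^{gp, 1/n} ↦ [a^{1/n}]^{gp}`.
[cite: MochizukiFrdI2008, §0 p.11] -/
theorem gpPerfComparison_mk_of (a : M) (n : ℕ+) :
    gpPerfComparison M (Perfection.mk (Algebra.GrothendieckGroup.of a) n) =
      Algebra.GrothendieckGroup.of (Perfection.mk a n) := by
  rw [← gpPerfInverse_of_mk, gpPerfComparison_gpPerfInverse]

/-- `gpPerfComparison` on general classes: `[a/b]^{1/n} ↦ [a^{1/n}]/[b^{1/n}]`.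
[cite: MochizukiFrdI2008, §0 p.11] -/
theorem gpPerfComparison_mk_div (a b : M) (n : ℕ+) :
    gpPerfComparison M (Perfection.mk (Algebra.GrothendieckGroup.of a / Algebra.GrothendieckGroup.of b) n) =
      Algebra.GrothendieckGroup.of (Perfection.mk a n) / Algebra.GrothendieckGroup.of (Perfection.mk b n) := by
  have h : Perfection.mk (Algebra.GrothendieckGroup.of a / Algebra.GrothendieckGroup.of b) n =
      Perfection.mk (Algebra.GrothendieckGroup.of a) n / Perfection.mk (Algebra.GrothendieckGroup.of b) n := by
    rw [div_eq_mul_inv, div_eq_mul_inv, ← Perfection.mk_inv, Perfection.mk_mul_mk, ← mul_pow,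
      Perfection.mk_pow_mul]
  rw [h, map_div, gpPerfComparison_mk_of, gpPerfComparison_mk_of]

end Interchange

/-! ### Small generic helpers for the split rational-function sequence -/

/-- **A product of perfect monoids is perfect.** [cite: MochizukiFrdI2008, §0 p.11] -/
theorem IsPerfect.prod {M : Type w} {N : Type v} [CommMonoid M] [CommMonoid N] (hM : IsPerfect M)
    (hN : IsPerfect N) : IsPerfect (M × N) := by
  refine ⟨fun n hn => ⟨fun x y hxy => ?_, fun y => ?_⟩⟩
  · have h1 : x.1 ^ n = y.1 ^ n := congrArg Prod.fst hxy
    have h2 : x.2 ^ n = y.2 ^ n := congrArg Prod.snd hxy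
    exact Prod.ext ((hM.bijective_pow n hn).1 h1) ((hN.bijective_pow n hn).1 h2)
  · obtain ⟨a, ha⟩ := (hM.bijective_pow n hn).2 y.1
    obtain ⟨b, hb⟩ := (hN.bijective_pow n hn).2 y.2
    exact ⟨(a, b), Prod.ext ha hb⟩

/-- A group whose multiplication commutes, as a commutative group (reducible constructor for `letI`,
e.g. on `O^×(A^birat)` for `A` birationally Frobenius-normalized, [FrdI] Def. 4.5 (i)).
[cite: MochizukiFrdI2008, Def. 4.5 (i) p.86] -/
abbrev commGroupOfComm {G : Type w} [Group G] (h : ∀ x y : G, x * y = y * x) : CommGroup G :=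
  { ‹Group G› with mul_comm := h }

end Literature.AlgebraicGeometry.Frobenioids

end
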